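import Literature.Topology.FourManifolds.SphereSurgeryOrientation
import Literature.Topology.FourManifolds.ClosedModelRelOrientation
import Literature.Topology.FourManifolds.RelFundamentalClassOfOrientation
import Literature.AlgebraicTopology.SingularHomology.OnePointCollapse
import Literature.AlgebraicTopology.SingularHomology.LocalHomologyOfSetTransfer
import HarnessLib

/-!
# The common collapse of the closed models before and after a surgery

Topic `Literature/Topology/FourManifolds` (fact seat of
`Literature.Topology.FourManifolds.HomotopySphere.exists_highlyConnected_of_mem_signatureSet`,
brick B6c).  M. Kervaire, J. Milnor, *Groups of homotopy spheres I*, Ann. of Math. 77 (1963),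
§5–§7 and A. Kosinski, *Differential Manifolds* (1993), X.3: the signature of a manifold bounded
by a homotopy sphere, computed on the closed homology manifold `Ŵ = W ∪ cone(bW)` (footnote
pp. 528–529), is not changed by a surgery `χ(W, φ)` on an interior sphere below the middle
dimension.  The tree has no atlas on `Ŵ` (Milnor's Prop. B is open there), so the comparison is
organised WITHOUT Poincaré duality, through the one space onto which both closed models collapse:
with `U = (W ∖ ∂W) ∖ S ≅ (χ ∖ ∂χ) ∖ S'` the common open piece (`S` the core sphere, `S'` the
cocore sphere), let `Z = U⁺` be its one-point compactification and

  `π : Ŵ → Z` (collapse `S ∪ {∞}`),  `π' : χ̂ → Z` (collapse `S' ∪ {∞}`)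

the two Pontryagin–Thom collapses (`OnePoint.collapse`, Milnor 1965 §7).  This file constructs
`U`, `Z`, `π`, `π'`, the three open embeddings `ι_X : U → Ŵ`, `ι_P : U → χ̂`, `ι_Z : U → Z`
(`π ∘ ι_X = ι_Z = π' ∘ ι_P`), and proves the homological heart of the comparison:

* `NullCobordism.isIso_localMap_of_isOpenEmbedding` — local homology at a compact set is local:
  `f_* : H_q(Y | K) ≅ H_q(X | f K)` for an open embedding `f` (Hatcher Thm. 2.20);
* `NullCobordism.toLocalOfSet_map_collapse_eq` — **the two fundamental classes agree on `Z` away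
  from `∞`**: for oriented-boundary data with locally matching fundamental classes
  (`exists_isOrientedBy_surgery_local`) and every compact `K ⊆ U`,
  `π_* [Ŵ]` and `π'_* [χ̂]` have the same image in `H_d(Z | K)` — both pull back, along the
  excision isomorphisms, to ONE class of `H_d(U | K)`, by Hatcher's Lemma 3.27 (a class of
  `H_d(U | K)` on the manifold `U` is determined by its local images, which are the common local
  orientations);
* `NullCobordism.kroneckerPairing_cupProduct_map_collapse_eq` — hence **the two collapses are
  isometric on classes supported in a compact part of `U`**: for `a, b ∈ H^*(Z; ℤ)` with `a`
  vanishing on `Z ∖ K`, `⟨a ⌣ b, π_* [Ŵ]⟩ = ⟨a ⌣ b, π'_* [χ̂]⟩` (the difference of the two classes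
  comes from `H_d(Z ∖ K)`, on which `a` restricts to zero; naturality of `⌣` and of the
  Kronecker pairing, Hatcher Prop. 3.10 and §3.1 p. 201).

The definitions (with bodies) are the topological objects `commonPiece`, `pieceIncl`,
`collapseTarget`, `ιX`, `ιP`, `ιZ`, `collapseX`, `collapseP`; everything else is proved; no
named facts.

## References

* M. Kervaire, J. Milnor, *Groups of homotopy spheres I*, Ann. of Math. 77 (1963), §5, §7 and
  footnote pp. 528–529. [KervaireMilnorAnnals1963]
* A. Kosinski, *Differential Manifolds* (1993), Ch. X §3, Prop. (3.3). [Kosinski1993]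
* J. Milnor, *Topology from the Differentiable Viewpoint* (1965), §7. [MilnorTDV1965]
* A. Hatcher, *Algebraic Topology* (2002), Thm. 2.20, §3.3 Lemma 3.27, Prop. 3.10, §3.1 p. 201.
  [HatcherAT2002]
-/

noncomputable section

open scoped Manifold ContDiff Topology
open Set Function Filter CategoryTheory Limits Topology
open Literature.AlgebraicTopology.SingularHomology

namespace Literature.Topology.FourManifolds

namespace NullCobordism

variable {m : ℕ}
variable {M : Type} [TopologicalSpace M] [ChartedSpace (EuclideanSpace ℝ (Fin (m + 1))) M]
  [IsManifold (𝓡 (m + 1)) ∞ M]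
  (c : NullCobordism (m + 1) M) {ι : Type} [Unique ι] {k l : ℕ}
  (ν : FramedSphereFamily (𝓡∂ (m + 1 + 1)) c.W ι k (l + 1)) (hkl : k + l = m + 1)

/-! ### §1 The common open piece `U = (W ∖ ∂W) ∖ S` and the three open embeddings -/

section CommonPiece

/-- **The common open piece** `U = (W ∖ ∂W) ∖ S` of `W` and `χ(W, φ)`: the interior points of
`W` off the core sphere, as an open subset of the interior manifold of `W`. [cite: KervaireMilnorAnnals1963, §5] -/
def commonPiece : TopologicalSpace.Opens c.Interior :=
  ⟨{v | v.val ∈ (ν.complement : Set c.W)},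
    ν.complement.2.preimage InteriorManifold.continuous_val⟩

omit [IsManifold (𝓡 (m + 1)) ∞ M] in
/-- Membership in the common piece. [folklore] -/
@[simp] theorem mem_commonPiece_iff (v : c.Interior) :
    v ∈ c.commonPiece ν ↔ v.val ∈ (ν.complement : Set c.W) := Iff.rfl

/-- The common piece as a subset of the surgery piece `W ∖ S`: `v ↦ v.val` (typed through the
piece `surgeryPiece`, whose underlying open set is `W ∖ S`). [folklore] -/
def pieceIncl : C(↥(c.commonPiece ν), ↥(c.surgeryPiece ν hkl).A) :=
  ⟨fun v => ⟨v.1.val, v.2⟩,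
    (InteriorManifold.continuous_val.comp continuous_subtype_val).subtype_mk _⟩

/-- Values of `pieceIncl`. [folklore] -/
@[simp] theorem coe_pieceIncl_apply (v : ↥(c.commonPiece ν)) :
    (c.pieceIncl ν hkl v : c.W) = v.1.val := rfl

/-- Points of the common piece are interior points of `W`. [folklore] -/
theorem pieceIncl_mem_interior (v : ↥(c.commonPiece ν)) :
    (c.pieceIncl ν hkl v : c.W) ∈ (𝓡∂ (m + 1 + 1)).interior c.W := v.1.property

/-- `pieceIncl` is injective. [folklore] -/
theorem pieceIncl_injective : Injective (c.pieceIncl ν hkl) := by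
  intro v w h
  have h' : v.1.val = w.1.val := congrArg (fun a : ↥(c.surgeryPiece ν hkl).A => (a : c.W)) h
  exact Subtype.ext (InteriorManifold.ext h')

/-- **`pieceIncl : U → W ∖ S` is an open embedding** (the restriction of the open embedding
`W ∖ ∂W ↪ W` over the open set `W ∖ S`). [folklore] -/
theorem isOpenEmbedding_pieceIncl : IsOpenEmbedding (c.pieceIncl ν hkl) := by
  have hval : IsOpenEmbedding (InteriorManifold.val : c.Interior → c.W) :=
    InteriorManifold.isOpenEmbedding_val
  have h1 : IsOpenEmbedding (fun v : ↥(c.commonPiece ν) => v.1.val) :=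
    hval.comp (c.commonPiece ν).2.isOpenEmbedding_subtypeVal
  -- `val ∘ pieceIncl = (v ↦ v.1.val)`
  have h2 : (Subtype.val : ↥(c.surgeryPiece ν hkl).A → c.W) ∘ c.pieceIncl ν hkl = fun v => v.1.val := rfl
  rw [← h2] at h1
  exact (IsOpenEmbedding.of_comp_iff (c.pieceIncl ν hkl)
    (c.surgeryPiece ν hkl).isOpenEmbedding_ι).1 h1

/-- **The open embedding `ι_X : U → Ŵ`**, `v ↦ q(v)` (`q : W → Ŵ` the boundary collapse; on the
interior it is the embedding `W ∖ ∂W ↪ Ŵ`). [cite: KervaireMilnorAnnals1963, §7, footnote pp. 528–529] -/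
def ιX : C(↥(c.commonPiece ν), ClosedModel (m + 1) c.W) :=
  (boundaryCollapse (m + 1) c.W).comp ((c.surgeryPiece ν hkl).ι.comp (c.pieceIncl ν hkl))

/-- Values of `ι_X`: `ι_X v = q (v.val) = ofInterior v`. [folklore] -/
theorem ιX_apply (v : ↥(c.commonPiece ν)) :
    c.ιX ν hkl v = boundaryCollapse (m + 1) c.W v.1.val := rfl

/-- `ι_X v` is the interior point `v` of the closed model. [folklore] -/
theorem ιX_apply_eq_ofInterior (v : ↥(c.commonPiece ν)) :
    c.ιX ν hkl v = ClosedModel.ofInterior ⟨v.1.val, v.1.property⟩ :=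
  boundaryCollapse_of_mem_interior v.1.property

/-- **`ι_X` is an open embedding.** [folklore] -/
theorem isOpenEmbedding_ιX : IsOpenEmbedding (c.ιX ν hkl) := by
  -- `ι_X = ofInterior ∘ g` with `g : U → W ∖ ∂W` an open embedding
  let g : ↥(c.commonPiece ν) → ManifoldInterior (m + 1) c.W := fun v => ⟨v.1.val, v.1.property⟩
  have hg : IsOpenEmbedding g := by
    have hval : IsOpenEmbedding (Subtype.val : ManifoldInterior (m + 1) c.W → c.W) :=
      ((𝓡∂ (m + 1 + 1)).isOpen_interior (M := c.W) one_ne_zero).isOpenEmbedding_subtypeVal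
    have h1 : IsOpenEmbedding (fun v : ↥(c.commonPiece ν) => v.1.val) :=
      InteriorManifold.isOpenEmbedding_val.comp (c.commonPiece ν).2.isOpenEmbedding_subtypeVal
    exact (IsOpenEmbedding.of_comp_iff g hval).1 h1
  have hfun : (c.ιX ν hkl : ↥(c.commonPiece ν) → ClosedModel (m + 1) c.W) = ClosedModel.ofInterior ∘ g :=
    funext fun v => c.ιX_apply_eq_ofInterior ν hkl v
  rw [hfun]
  exact OnePoint.isOpenEmbedding_coe.comp hg

/-- **The open embedding `ι_P : U → χ̂`**, `v ↦ q'(inl v)`. [cite: KervaireMilnorAnnals1963, §7, footnote pp. 528–529] -/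
def ιP : C(↥(c.commonPiece ν), ClosedModel (m + 1) (c.surgery ν hkl).W) :=
  (boundaryCollapse (m + 1) (c.surgery ν hkl).W).comp
    ((c.surgeryPiece ν hkl).j.comp (c.pieceIncl ν hkl))

/-- Values of `ι_P`. [folklore] -/
theorem ιP_apply (v : ↥(c.commonPiece ν)) :
    c.ιP ν hkl v = boundaryCollapse (m + 1) (c.surgery ν hkl).W
      ((c.surgeryPiece ν hkl).j (c.pieceIncl ν hkl v)) := rfl

/-- `inl v` is an interior point of `χ`. [folklore] -/
theorem j_pieceIncl_mem_interior (v : ↥(c.commonPiece ν)) :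
    (c.surgeryPiece ν hkl).j (c.pieceIncl ν hkl v) ∈ (𝓡∂ (m + 1 + 1)).interior (c.surgery ν hkl).W :=
  (c.surgeryPiece ν hkl).j_mem_interior (c.pieceIncl_mem_interior ν hkl v)

/-- `ι_P v` is the interior point `inl v` of the closed model of `χ`. [folklore] -/
theorem ιP_apply_eq_ofInterior (v : ↥(c.commonPiece ν)) :
    c.ιP ν hkl v = ClosedModel.ofInterior ⟨(c.surgeryPiece ν hkl).j (c.pieceIncl ν hkl v),
      c.j_pieceIncl_mem_interior ν hkl v⟩ :=
  boundaryCollapse_of_mem_interior (c.j_pieceIncl_mem_interior ν hkl v)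

/-- **`ι_P` is an open embedding.** [folklore] -/
theorem isOpenEmbedding_ιP : IsOpenEmbedding (c.ιP ν hkl) := by
  let g : ↥(c.commonPiece ν) → ManifoldInterior (m + 1) (c.surgery ν hkl).W := fun v =>
    ⟨(c.surgeryPiece ν hkl).j (c.pieceIncl ν hkl v), c.j_pieceIncl_mem_interior ν hkl v⟩
  have hg : IsOpenEmbedding g := by
    have hval : IsOpenEmbedding (Subtype.val : ManifoldInterior (m + 1) (c.surgery ν hkl).W →
        (c.surgery ν hkl).W) :=
      ((𝓡∂ (m + 1 + 1)).isOpen_interior (M := (c.surgery ν hkl).W) one_ne_zero).isOpenEmbedding_subtypeVal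
    have h1 : IsOpenEmbedding (fun v : ↥(c.commonPiece ν) =>
        (c.surgeryPiece ν hkl).j (c.pieceIncl ν hkl v)) :=
      (c.surgeryPiece ν hkl).isOpenEmbedding_j.comp (c.isOpenEmbedding_pieceIncl ν hkl)
    exact (IsOpenEmbedding.of_comp_iff g hval).1 h1
  have hfun : (c.ιP ν hkl : ↥(c.commonPiece ν) → ClosedModel (m + 1) (c.surgery ν hkl).W) =
      ClosedModel.ofInterior ∘ g :=
    funext fun v => c.ιP_apply_eq_ofInterior ν hkl v
  rw [hfun]
  exact OnePoint.isOpenEmbedding_coe.comp hg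

/-- **The collapse target `Z = U⁺`**, the one-point compactification of the common piece, onto
which both closed models collapse. [cite: MilnorTDV1965, §7] -/
abbrev collapseTarget : Type := OnePoint ↥(c.commonPiece ν)

/-- The open embedding `ι_Z : U → Z = U⁺`. [folklore] -/
def ιZ : C(↥(c.commonPiece ν), c.collapseTarget ν) := ⟨(↑), OnePoint.continuous_coe⟩

omit [IsManifold (𝓡 (m + 1)) ∞ M] in
/-- Values of `ι_Z`. [folklore] -/
@[simp] theorem ιZ_apply (v : ↥(c.commonPiece ν)) : c.ιZ ν v = (v : OnePoint ↥(c.commonPiece ν)) := rfl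

omit [IsManifold (𝓡 (m + 1)) ∞ M] in
/-- `ι_Z` is an open embedding. [folklore] -/
theorem isOpenEmbedding_ιZ : IsOpenEmbedding (c.ιZ ν) := OnePoint.isOpenEmbedding_coe

end CommonPiece

/-! ### §2 The two collapses `π : Ŵ → Z`, `π' : χ̂ → Z` -/

section Collapse

/-- **The collapse `π : Ŵ → Z`**: the identity on `U`, and `S ∪ {∞} ↦ ∞` (Pontryagin–Thom
collapse `OnePoint.collapse` along the open embedding `ι_X`). [cite: MilnorTDV1965, §7] -/
def collapseX : C(ClosedModel (m + 1) c.W, c.collapseTarget ν) :=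
  OnePoint.collapseCM (c.isOpenEmbedding_ιX ν hkl).isOpen_range
    (c.isOpenEmbedding_ιX ν hkl).isEmbedding.toHomeomorph.symm

/-- **The collapse `π' : χ̂ → Z`**: the identity on `U`, and `S' ∪ {∞} ↦ ∞`. [cite: MilnorTDV1965, §7] -/
def collapseP : C(ClosedModel (m + 1) (c.surgery ν hkl).W, c.collapseTarget ν) :=
  OnePoint.collapseCM (c.isOpenEmbedding_ιP ν hkl).isOpen_range
    (c.isOpenEmbedding_ιP ν hkl).isEmbedding.toHomeomorph.symm

/-- A general computation: the collapse along an open embedding `f` sends `f v` to `v`.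
[folklore] -/
theorem collapse_apply_of_isOpenEmbedding {X Y : Type} [TopologicalSpace X] [TopologicalSpace Y]
    [T2Space X] {f : Y → X} (hf : IsOpenEmbedding f) (v : Y) :
    OnePoint.collapseCM hf.isOpen_range hf.isEmbedding.toHomeomorph.symm (f v) =
      ((v : Y) : OnePoint Y) := by
  rw [OnePoint.collapseCM_apply, OnePoint.collapse_apply_of_mem (range f) _ (mem_range_self v)]
  congr 1
  rw [Homeomorph.symm_apply_eq]
  exact Subtype.ext (hf.isEmbedding.toHomeomorph_apply_coe v).symm

/-- `π (ι_X v) = v`. [folklore] -/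
@[simp] theorem collapseX_ιX (v : ↥(c.commonPiece ν)) : c.collapseX ν hkl (c.ιX ν hkl v) = (v : OnePoint _) :=
  collapse_apply_of_isOpenEmbedding (c.isOpenEmbedding_ιX ν hkl) v

/-- `π' (ι_P v) = v`. [folklore] -/
@[simp] theorem collapseP_ιP (v : ↥(c.commonPiece ν)) :
    c.collapseP ν hkl (c.ιP ν hkl v) = (v : OnePoint _) :=
  collapse_apply_of_isOpenEmbedding (c.isOpenEmbedding_ιP ν hkl) v

/-- Off `ι_X(U)` the collapse `π` is `∞`. [folklore] -/
theorem collapseX_apply_of_not_mem {x : ClosedModel (m + 1) c.W} (hx : x ∉ range (c.ιX ν hkl)) :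
    c.collapseX ν hkl x = OnePoint.infty :=
  OnePoint.collapse_apply_of_not_mem _ _ hx

/-- Off `ι_P(U)` the collapse `π'` is `∞`. [folklore] -/
theorem collapseP_apply_of_not_mem {x : ClosedModel (m + 1) (c.surgery ν hkl).W}
    (hx : x ∉ range (c.ιP ν hkl)) : c.collapseP ν hkl x = OnePoint.infty :=
  OnePoint.collapse_apply_of_not_mem _ _ hx

/-- `π ∘ ι_X = ι_Z`. [folklore] -/
theorem collapseX_comp_ιX : (c.collapseX ν hkl).comp (c.ιX ν hkl) = c.ιZ ν := by
  ext v : 1; exact c.collapseX_ιX ν hkl v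

/-- `π' ∘ ι_P = ι_Z`. [folklore] -/
theorem collapseP_comp_ιP : (c.collapseP ν hkl).comp (c.ιP ν hkl) = c.ιZ ν := by
  ext v : 1; exact c.collapseP_ιP ν hkl v

/-- `π` is a map of pairs `(Ŵ, Ŵ ∖ ι_X K) → (Z, Z ∖ ι_Z K)`. [folklore] -/
theorem mapsTo_collapseX (K : Set ↥(c.commonPiece ν)) :
    MapsTo (c.collapseX ν hkl) ((c.ιX ν hkl '' K)ᶜ) ((c.ιZ ν '' K)ᶜ) := by
  intro x hx hx'
  obtain ⟨v, hv, hvx⟩ := hx'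
  by_cases hxr : x ∈ range (c.ιX ν hkl)
  · obtain ⟨w, rfl⟩ := hxr
    rw [c.collapseX_ιX ν hkl w] at hvx
    have hvw : v = w := OnePoint.coe_injective hvx
    exact hx ⟨w, hvw ▸ hv, rfl⟩
  · rw [c.collapseX_apply_of_not_mem ν hkl hxr] at hvx
    exact OnePoint.coe_ne_infty v hvx

/-- `π'` is a map of pairs `(χ̂, χ̂ ∖ ι_P K) → (Z, Z ∖ ι_Z K)`. [folklore] -/
theorem mapsTo_collapseP (K : Set ↥(c.commonPiece ν)) :
    MapsTo (c.collapseP ν hkl) ((c.ιP ν hkl '' K)ᶜ) ((c.ιZ ν '' K)ᶜ) := by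
  intro x hx hx'
  obtain ⟨v, hv, hvx⟩ := hx'
  by_cases hxr : x ∈ range (c.ιP ν hkl)
  · obtain ⟨w, rfl⟩ := hxr
    rw [c.collapseP_ιP ν hkl w] at hvx
    have hvw : v = w := OnePoint.coe_injective hvx
    exact hx ⟨w, hvw ▸ hv, rfl⟩
  · rw [c.collapseP_apply_of_not_mem ν hkl hxr] at hvx
    exact OnePoint.coe_ne_infty v hvx

end Collapse

/-! ### §3 Local homology at a compact set is local (open embeddings) -/

section Excision

variable {X Y : Type} [TopologicalSpace X] [TopologicalSpace Y]

omit [TopologicalSpace X] [TopologicalSpace Y] in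
/-- An injective map is a map of pairs `(Y, Y ∖ K) → (X, X ∖ f K)`. [folklore] -/
theorem mapsTo_compl_image_of_injective {f : Y → X} (hf : Injective f) (K : Set Y) :
    MapsTo f (Kᶜ) ((f '' K)ᶜ) := fun _ hy ⟨_, hy', h⟩ => hy (hf h ▸ hy')

/-- **A homeomorphism of pairs induces isomorphisms of relative homology.** [folklore] -/
theorem isIso_relMap_of_homeomorph (R : Type) [CommRing R] (G : Type) [AddCommGroup G] [Module R G]
    (e : Y ≃ₜ X) {A : Set Y} {B : Set X} (hA : MapsTo e A B) (hB : MapsTo e.symm B A) (q : ℕ) :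
    IsIso (relativeSingularHomology.map R G (e : C(Y, X)) hA q) := by
  refine ⟨⟨relativeSingularHomology.map R G (e.symm : C(X, Y)) hB q, ?_, ?_⟩⟩
  · rw [← relativeSingularHomology.map_comp]
    have h : ((e.symm : C(X, Y)).comp (e : C(Y, X))) = ContinuousMap.id Y := by
      ext y; exact e.symm_apply_apply y
    rw [relativeSingularHomology.map_congr_left R G h (hB.comp hA) (mapsTo_id A) q,
      relativeSingularHomology.map_id]
  · rw [← relativeSingularHomology.map_comp]
    have h : ((e : C(Y, X)).comp (e.symm : C(X, Y))) = ContinuousMap.id X := by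
      ext x; exact e.apply_symm_apply x
    rw [relativeSingularHomology.map_congr_left R G h (hA.comp hB) (mapsTo_id B) q,
      relativeSingularHomology.map_id]

/-- **Local homology at a compact set is local** (Hatcher 2002, Thm. 2.20 and §3.3 p. 233): for
an open embedding `f : Y → X` into a Hausdorff space and a compact `K ⊆ Y`,
`f_* : H_q(Y | K; G) ≅ H_q(X | f K; G)` — `f` is a homeomorphism onto the open set `f(Y) ⊇ f(K)`
followed by the excision `H_q(f(Y) | f K) ≅ H_q(X | f K)` (`isIso_map_subsetIncl_of_isClosed`).
[cite: HatcherAT2002, Thm. 2.20] -/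
theorem isIso_localMap_of_isOpenEmbedding (R : Type) [CommRing R] (G : Type) [AddCommGroup G]
    [Module R G] [T2Space X] {f : C(Y, X)} (hf : IsOpenEmbedding f) {K : Set Y} (hK : IsCompact K)
    (q : ℕ) :
    IsIso (relativeSingularHomology.map R G f (mapsTo_compl_image_of_injective hf.injective K) q) := by
  let e : Y ≃ₜ ↥(range f) := hf.isEmbedding.toHomeomorph
  have hfac : f = (subsetIncl (range f)).comp (e : C(Y, ↥(range f))) := by ext y; rfl
  have hKc : IsClosed (f '' K) := (hK.image f.continuous).isClosed
  -- the homeomorphism part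
  have hA : MapsTo (e : C(Y, ↥(range f))) (Kᶜ) ((Subtype.val ⁻¹' (f '' K))ᶜ) := by
    intro y hy hy'
    obtain ⟨y', hy'K, h⟩ := hy'
    exact hy (hf.injective h ▸ hy'K)
  have hB : MapsTo (e.symm : C(↥(range f), Y)) ((Subtype.val ⁻¹' (f '' K))ᶜ) (Kᶜ) := by
    intro z hz hzK
    apply hz
    refine ⟨e.symm z, hzK, ?_⟩
    have : (e (e.symm z) : X) = f (e.symm z) := hf.isEmbedding.toHomeomorph_apply_coe _
    rw [← this, e.apply_symm_apply]
  haveI h1 := isIso_relMap_of_homeomorph R G e hA hB q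
  haveI h2 := localHomologyOfSet.isIso_map_subsetIncl_of_isClosed R G hf.isOpen_range hKc
    (image_subset_range f K) q
  rw [relativeSingularHomology.map_congr_left R G hfac _
    ((localHomologyOfSet.mapsTo_val_compl (range f) (f '' K)).comp hA) q,
    relativeSingularHomology.map_comp R G (e : C(Y, ↥(range f))) (subsetIncl (range f)) hA
      (localHomologyOfSet.mapsTo_val_compl (range f) (f '' K)) q]
  exact IsIso.comp_isIso

end Excision

/-! ### §4 The two fundamental classes agree on `Z` away from `∞` -/

section Pointwise

variable {X Y : Type} [TopologicalSpace X] [TopologicalSpace Y]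

/-- Restriction to a point commutes with push-forward along an injective map:
`f_* (ξ|ₓ) = (f_* ξ)|_{f x}`. [folklore] -/
theorem map_restrictToPoint_eq (R : Type) [CommRing R] (G : Type) [AddCommGroup G] [Module R G]
    (f : C(Y, X)) (hf : Injective f) {K : Set Y} {x : Y} (hx : x ∈ K) (q : ℕ)
    (ξ : localHomologyOfSet R G Y K q) :
    relativeSingularHomology.map R G f (LocalFamily.mapsTo_compl_pt hf x) q
        (restrictToPoint R G hx q ξ) =
      restrictToPoint R G (mem_image_of_mem f hx) q
        (relativeSingularHomology.map R G f (mapsTo_compl_image_of_injective hf K) q ξ) := by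
  rw [restrictToPoint, restrictLocal, restrictToPoint, restrictLocal, ← ModuleCat.comp_apply,
    ← ModuleCat.comp_apply, ← relativeSingularHomology.map_comp, ← relativeSingularHomology.map_comp]
  rfl

/-- Injectivity of an isomorphism of modules, as a function. [folklore] -/
theorem injective_of_isIso {R : Type} [CommRing R] {A B : ModuleCat.{0} R} (f : A ⟶ B) [IsIso f] :
    Injective f :=
  (ModuleCat.mono_iff_injective f).1 inferInstance

end Pointwise

section FundamentalClassTransfer

variable {c ν hkl}
variable {w : relativeSingularHomology ℤ ℤ c.W ((𝓡∂ (m + 1 + 1)).boundary c.W) (m + 1 + 1)}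
  {w' : relativeSingularHomology ℤ ℤ (c.surgery ν hkl).W
    ((𝓡∂ (m + 1 + 1)).boundary (c.surgery ν hkl).W) (m + 1 + 1)}
  {μ' : HomologicalOrientation ℤ (ClosedModel (m + 1) c.W) (m + 1 + 1)}
  {μ'' : HomologicalOrientation ℤ (ClosedModel (m + 1) (c.surgery ν hkl).W) (m + 1 + 1)}

/-- `(ι_X)_* = q_* ∘ ι_* ∘ (pieceIncl)_*` on local homology at a point. [folklore] -/
theorem localMap_ιX_eq (x : ↥(c.commonPiece ν)) :
    relativeSingularHomology.map ℤ ℤ (c.ιX ν hkl)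
        (LocalFamily.mapsTo_compl_pt (c.isOpenEmbedding_ιX ν hkl).injective x) (m + 1 + 1) =
      relativeSingularHomology.map ℤ ℤ (c.pieceIncl ν hkl)
          (LocalFamily.mapsTo_compl_pt (c.pieceIncl_injective ν hkl) x) (m + 1 + 1) ≫
        relativeSingularHomology.map ℤ ℤ (c.surgeryPiece ν hkl).ι
          (LocalFamily.mapsTo_compl_pt (c.surgeryPiece ν hkl).ι_injective (c.pieceIncl ν hkl x))
          (m + 1 + 1) ≫
        relativeSingularHomology.map ℤ ℤ (boundaryCollapse (m + 1) c.W)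
          (c.mapsTo_boundaryCollapse_compl_singleton (c.pieceIncl_mem_interior ν hkl x)) (m + 1 + 1) := by
  rw [← relativeSingularHomology.map_comp, ← relativeSingularHomology.map_comp]
  rfl

/-- `(ι_P)_* = q'_* ∘ inl_* ∘ (pieceIncl)_*` on local homology at a point. [folklore] -/
theorem localMap_ιP_eq (x : ↥(c.commonPiece ν)) :
    relativeSingularHomology.map ℤ ℤ (c.ιP ν hkl)
        (LocalFamily.mapsTo_compl_pt (c.isOpenEmbedding_ιP ν hkl).injective x) (m + 1 + 1) =
      relativeSingularHomology.map ℤ ℤ (c.pieceIncl ν hkl)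
          (LocalFamily.mapsTo_compl_pt (c.pieceIncl_injective ν hkl) x) (m + 1 + 1) ≫
        relativeSingularHomology.map ℤ ℤ (c.surgeryPiece ν hkl).j
          (LocalFamily.mapsTo_compl_pt (c.surgeryPiece ν hkl).j_injective (c.pieceIncl ν hkl x))
          (m + 1 + 1) ≫
        relativeSingularHomology.map ℤ ℤ (boundaryCollapse (m + 1) (c.surgery ν hkl).W)
          ((c.surgery ν hkl).mapsTo_boundaryCollapse_compl_singleton
            (c.j_pieceIncl_mem_interior ν hkl x)) (m + 1 + 1) := by
  rw [← relativeSingularHomology.map_comp, ← relativeSingularHomology.map_comp]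
  rfl

/-- **The local classes of `[Ŵ]` over the common piece, pulled back to `U`.**  For oriented-
boundary data with `[Ŵ]_{μ'} = c_w` and any class `ξ ∈ H_d(U | K)` with
`(ι_X)_* ξ = [Ŵ]|_{ι_X K}`, the local class `ξ|ₓ` (`x ∈ K`) is the pull-back of the local
orientation: `(pieceIncl)_* (ξ|ₓ) = pieceClass w x`. [cite: HatcherAT2002, §3.3 p. 253 (relative fundamental class)] -/
theorem map_pieceIncl_restrictToPoint_eq_pieceClass_X
    (hμ' : μ'.fundamentalClass = c.closedModelClass ℤ ℤ (Nat.le_add_left 1 m) w)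
    {K : Set ↥(c.commonPiece ν)} {x : ↥(c.commonPiece ν)} (hx : x ∈ K)
    (ξ : localHomologyOfSet ℤ ℤ ↥(c.commonPiece ν) K (m + 1 + 1))
    (hξ : relativeSingularHomology.map ℤ ℤ (c.ιX ν hkl)
        (mapsTo_compl_image_of_injective (c.isOpenEmbedding_ιX ν hkl).injective K) (m + 1 + 1) ξ =
      singularHomology.toLocalOfSet ℤ ℤ _ (c.ιX ν hkl '' K) (m + 1 + 1) μ'.fundamentalClass) :
    relativeSingularHomology.map ℤ ℤ (c.pieceIncl ν hkl)
        (LocalFamily.mapsTo_compl_pt (c.pieceIncl_injective ν hkl) x) (m + 1 + 1)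
        (restrictToPoint ℤ ℤ hx (m + 1 + 1) ξ) =
      (c.surgeryPiece ν hkl).pieceClass w (c.pieceIncl ν hkl x) := by
  have haint : ((c.pieceIncl ν hkl x : ↥(c.surgeryPiece ν hkl).A) : c.W) ∈
      (𝓡∂ (m + 1 + 1)).interior c.W := c.pieceIncl_mem_interior ν hkl x
  have haB : ((c.pieceIncl ν hkl x : ↥(c.surgeryPiece ν hkl).A) : c.W) ∈
      ((𝓡∂ (m + 1 + 1)).boundary c.W)ᶜ := c.not_mem_boundary_of_mem_interior haint
  -- (i) `(ι_X)_* (ξ|ₓ) = [Ŵ]|_{ι_X x}`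
  have h1 : relativeSingularHomology.map ℤ ℤ (c.ιX ν hkl)
      (LocalFamily.mapsTo_compl_pt (c.isOpenEmbedding_ιX ν hkl).injective x) (m + 1 + 1)
        (restrictToPoint ℤ ℤ hx (m + 1 + 1) ξ) =
      singularHomology.toLocal ℤ ℤ (c.ιX ν hkl x) (m + 1 + 1) μ'.fundamentalClass := by
    rw [map_restrictToPoint_eq ℤ ℤ (c.ιX ν hkl) (c.isOpenEmbedding_ιX ν hkl).injective hx (m + 1 + 1) ξ,
      hξ, singularHomology.restrictToPoint_toLocalOfSet]
  -- (ii) `[Ŵ]|_{q a} = q_* (w|_a) = q_* (ι_* (pieceClass w a))`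
  have h2a := congrArg (singularHomology.toLocal ℤ ℤ (c.ιX ν hkl x) (m + 1 + 1)) hμ'
  have h2b := c.toLocal_closedModelClass_of_mem_interior ℤ ℤ (Nat.le_add_left 1 m) w haint
  have h2c := congrArg (relativeSingularHomology.map ℤ ℤ (boundaryCollapse (m + 1) c.W)
    (c.mapsTo_boundaryCollapse_compl_singleton haint) (m + 1 + 1))
    ((c.surgeryPiece ν hkl).map_ι_pieceClass_of_mem w (c.pieceIncl ν hkl x) haB).symm
  have h2 := h2a.trans (h2b.trans h2c)
  -- (iii) `(ι_X)_* = q_* ∘ ι_* ∘ (pieceIncl)_*`, then cancel the two local isomorphisms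
  have h3 : relativeSingularHomology.map ℤ ℤ (c.ιX ν hkl)
      (LocalFamily.mapsTo_compl_pt (c.isOpenEmbedding_ιX ν hkl).injective x) (m + 1 + 1)
        (restrictToPoint ℤ ℤ hx (m + 1 + 1) ξ) =
      relativeSingularHomology.map ℤ ℤ (boundaryCollapse (m + 1) c.W)
        (c.mapsTo_boundaryCollapse_compl_singleton haint) (m + 1 + 1)
        (relativeSingularHomology.map ℤ ℤ (c.surgeryPiece ν hkl).ι
          (LocalFamily.mapsTo_compl_pt (c.surgeryPiece ν hkl).ι_injective (c.pieceIncl ν hkl x))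
          (m + 1 + 1)
          (relativeSingularHomology.map ℤ ℤ (c.pieceIncl ν hkl)
            (LocalFamily.mapsTo_compl_pt (c.pieceIncl_injective ν hkl) x) (m + 1 + 1)
            (restrictToPoint ℤ ℤ hx (m + 1 + 1) ξ))) :=
    ConcreteCategory.congr_hom (localMap_ιX_eq (hkl := hkl) x) (restrictToPoint ℤ ℤ hx (m + 1 + 1) ξ)
  haveI := c.isIso_localMap_boundaryCollapse ℤ ℤ haint (m + 1 + 1)
  haveI := localHomology.isIso_map_of_isOpenEmbedding_of_eq ℤ ℤ (c.surgeryPiece ν hkl).ι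
    (c.surgeryPiece ν hkl).isOpenEmbedding_ι (c.pieceIncl ν hkl x) rfl (m + 1 + 1)
  apply injective_of_isIso (relativeSingularHomology.map ℤ ℤ (c.surgeryPiece ν hkl).ι
    (LocalFamily.mapsTo_compl_pt (c.surgeryPiece ν hkl).ι_injective (c.pieceIncl ν hkl x)) (m + 1 + 1))
  apply injective_of_isIso (relativeSingularHomology.map ℤ ℤ (boundaryCollapse (m + 1) c.W)
    (c.mapsTo_boundaryCollapse_compl_singleton haint) (m + 1 + 1))
  exact h3.symm.trans (h1.trans h2)

/-- The `χ̂` half of `map_pieceIncl_restrictToPoint_eq_pieceClass_X`: with `[χ̂]_{μ''} = c_{w'}`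
and the local agreement `w'|_{inl a} = inl_* (w|_a)`, a class `ξ ∈ H_d(U | K)` with
`(ι_P)_* ξ = [χ̂]|_{ι_P K}` has `(pieceIncl)_* (ξ|ₓ) = pieceClass w x`. [cite: HatcherAT2002, §3.3 p. 253 (relative fundamental class)] -/
theorem map_pieceIncl_restrictToPoint_eq_pieceClass_P
    (hμ'' : μ''.fundamentalClass =
      (c.surgery ν hkl).closedModelClass ℤ ℤ (Nat.le_add_left 1 m) w')
    (hloc : ∀ (a : ↥ν.complement) (ha : (a : c.W) ∈ (𝓡∂ (m + 1 + 1)).interior c.W),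
        relativeSingularHomology.toLocal ℤ ℤ ((𝓡∂ (m + 1 + 1)).boundary (c.surgery ν hkl).W)
            ⟨(c.surgeryPiece ν hkl).j a, (c.surgeryPiece ν hkl).j_mem_compl_boundary
              (c.not_mem_boundary_of_mem_interior ha)⟩ (m + 1 + 1) w' =
          relativeSingularHomology.map ℤ ℤ (c.surgeryPiece ν hkl).j
            (LocalFamily.mapsTo_compl_pt (c.surgeryPiece ν hkl).j_injective a)
            (m + 1 + 1) ((c.surgeryPiece ν hkl).pieceClass w a))
    {K : Set ↥(c.commonPiece ν)} {x : ↥(c.commonPiece ν)} (hx : x ∈ K)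
    (ξ : localHomologyOfSet ℤ ℤ ↥(c.commonPiece ν) K (m + 1 + 1))
    (hξ : relativeSingularHomology.map ℤ ℤ (c.ιP ν hkl)
        (mapsTo_compl_image_of_injective (c.isOpenEmbedding_ιP ν hkl).injective K) (m + 1 + 1) ξ =
      singularHomology.toLocalOfSet ℤ ℤ _ (c.ιP ν hkl '' K) (m + 1 + 1) μ''.fundamentalClass) :
    relativeSingularHomology.map ℤ ℤ (c.pieceIncl ν hkl)
        (LocalFamily.mapsTo_compl_pt (c.pieceIncl_injective ν hkl) x) (m + 1 + 1)
        (restrictToPoint ℤ ℤ hx (m + 1 + 1) ξ) =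
      (c.surgeryPiece ν hkl).pieceClass w (c.pieceIncl ν hkl x) := by
  have haint : ((c.pieceIncl ν hkl x : ↥(c.surgeryPiece ν hkl).A) : c.W) ∈
      (𝓡∂ (m + 1 + 1)).interior c.W := c.pieceIncl_mem_interior ν hkl x
  have hjint : (c.surgeryPiece ν hkl).j (c.pieceIncl ν hkl x) ∈
      (𝓡∂ (m + 1 + 1)).interior (c.surgery ν hkl).W := c.j_pieceIncl_mem_interior ν hkl x
  -- (i)
  have h1 : relativeSingularHomology.map ℤ ℤ (c.ιP ν hkl)
      (LocalFamily.mapsTo_compl_pt (c.isOpenEmbedding_ιP ν hkl).injective x) (m + 1 + 1)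
        (restrictToPoint ℤ ℤ hx (m + 1 + 1) ξ) =
      singularHomology.toLocal ℤ ℤ (c.ιP ν hkl x) (m + 1 + 1) μ''.fundamentalClass := by
    rw [map_restrictToPoint_eq ℤ ℤ (c.ιP ν hkl) (c.isOpenEmbedding_ιP ν hkl).injective hx
      (m + 1 + 1) ξ, hξ, singularHomology.restrictToPoint_toLocalOfSet]
  -- (ii) `[χ̂]|_{q' (inl a)} = q'_* (w'|_{inl a}) = q'_* (inl_* (pieceClass w a))`
  have h2a := congrArg (singularHomology.toLocal ℤ ℤ (c.ιP ν hkl x) (m + 1 + 1)) hμ''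
  have h2b := (c.surgery ν hkl).toLocal_closedModelClass_of_mem_interior ℤ ℤ (Nat.le_add_left 1 m)
    w' hjint
  have h2c := congrArg (relativeSingularHomology.map ℤ ℤ
    (boundaryCollapse (m + 1) (c.surgery ν hkl).W)
    ((c.surgery ν hkl).mapsTo_boundaryCollapse_compl_singleton hjint) (m + 1 + 1))
    (hloc (c.pieceIncl ν hkl x) haint)
  have h2 := h2a.trans (h2b.trans h2c)
  -- (iii)
  have h3 : relativeSingularHomology.map ℤ ℤ (c.ιP ν hkl)
      (LocalFamily.mapsTo_compl_pt (c.isOpenEmbedding_ιP ν hkl).injective x) (m + 1 + 1)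
        (restrictToPoint ℤ ℤ hx (m + 1 + 1) ξ) =
      relativeSingularHomology.map ℤ ℤ (boundaryCollapse (m + 1) (c.surgery ν hkl).W)
        ((c.surgery ν hkl).mapsTo_boundaryCollapse_compl_singleton hjint) (m + 1 + 1)
        (relativeSingularHomology.map ℤ ℤ (c.surgeryPiece ν hkl).j
          (LocalFamily.mapsTo_compl_pt (c.surgeryPiece ν hkl).j_injective (c.pieceIncl ν hkl x))
          (m + 1 + 1)
          (relativeSingularHomology.map ℤ ℤ (c.pieceIncl ν hkl)
            (LocalFamily.mapsTo_compl_pt (c.pieceIncl_injective ν hkl) x) (m + 1 + 1)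
            (restrictToPoint ℤ ℤ hx (m + 1 + 1) ξ))) :=
    ConcreteCategory.congr_hom (localMap_ιP_eq (hkl := hkl) x) (restrictToPoint ℤ ℤ hx (m + 1 + 1) ξ)
  haveI := (c.surgery ν hkl).isIso_localMap_boundaryCollapse ℤ ℤ hjint (m + 1 + 1)
  haveI := localHomology.isIso_map_of_isOpenEmbedding_of_eq ℤ ℤ (c.surgeryPiece ν hkl).j
    (c.surgeryPiece ν hkl).isOpenEmbedding_j (c.pieceIncl ν hkl x) rfl (m + 1 + 1)
  apply injective_of_isIso (relativeSingularHomology.map ℤ ℤ (c.surgeryPiece ν hkl).j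
    (LocalFamily.mapsTo_compl_pt (c.surgeryPiece ν hkl).j_injective (c.pieceIncl ν hkl x)) (m + 1 + 1))
  apply injective_of_isIso (relativeSingularHomology.map ℤ ℤ
    (boundaryCollapse (m + 1) (c.surgery ν hkl).W)
    ((c.surgery ν hkl).mapsTo_boundaryCollapse_compl_singleton hjint) (m + 1 + 1))
  exact h3.symm.trans (h1.trans h2)

/-- **The two fundamental classes agree on `Z` away from `∞`** (the homological heart of the
invariance of the signature under surgery, Kervaire–Milnor 1963 §5–§7, organised without
Poincaré duality): for oriented-boundary data with locally matching fundamental classes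
(`[Ŵ]_{μ'} = c_w`, `[χ̂]_{μ''} = c_{w'}`, `w'|_{inl a} = inl_* (w|_a)` over `W ∖ S`) and every
compact `K ⊆ U`, the classes `π_* [Ŵ]` and `π'_* [χ̂]` of `H_d(Z)` have the same image in
`H_d(Z | K)`.  Proof: both `[Ŵ]|_{ι_X K}` and `[χ̂]|_{ι_P K}` pull back along the excision
isomorphisms `H_d(U | K) ≅ H_d(Ŵ | ι_X K)`, `≅ H_d(χ̂ | ι_P K)` to classes of `H_d(U | K)` with
the SAME local images (the common local orientations), hence to the same class (Hatcher's
Lemma 3.27 on the manifold `U`, `eq_of_forall_restrictToPoint_eq_of_isCompact`); push forward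
along `π ∘ ι_X = ι_Z = π' ∘ ι_P`. [cite: KervaireMilnorAnnals1963, §5 and §7, footnote pp. 528–529] -/
theorem toLocalOfSet_map_collapse_eq
    (hμ' : μ'.fundamentalClass = c.closedModelClass ℤ ℤ (Nat.le_add_left 1 m) w)
    (hμ'' : μ''.fundamentalClass =
      (c.surgery ν hkl).closedModelClass ℤ ℤ (Nat.le_add_left 1 m) w')
    (hloc : ∀ (a : ↥ν.complement) (ha : (a : c.W) ∈ (𝓡∂ (m + 1 + 1)).interior c.W),
        relativeSingularHomology.toLocal ℤ ℤ ((𝓡∂ (m + 1 + 1)).boundary (c.surgery ν hkl).W)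
            ⟨(c.surgeryPiece ν hkl).j a, (c.surgeryPiece ν hkl).j_mem_compl_boundary
              (c.not_mem_boundary_of_mem_interior ha)⟩ (m + 1 + 1) w' =
          relativeSingularHomology.map ℤ ℤ (c.surgeryPiece ν hkl).j
            (LocalFamily.mapsTo_compl_pt (c.surgeryPiece ν hkl).j_injective a)
            (m + 1 + 1) ((c.surgeryPiece ν hkl).pieceClass w a))
    {K : Set ↥(c.commonPiece ν)} (hK : IsCompact K) :
    singularHomology.toLocalOfSet ℤ ℤ _ (c.ιZ ν '' K) (m + 1 + 1)
        (singularHomology.map ℤ ℤ (c.collapseX ν hkl) (m + 1 + 1) μ'.fundamentalClass) =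
      singularHomology.toLocalOfSet ℤ ℤ _ (c.ιZ ν '' K) (m + 1 + 1)
        (singularHomology.map ℤ ℤ (c.collapseP ν hkl) (m + 1 + 1) μ''.fundamentalClass) := by
  -- the two excision isomorphisms
  haveI iX : IsIso (relativeSingularHomology.map ℤ ℤ (c.ιX ν hkl)
      (mapsTo_compl_image_of_injective (c.isOpenEmbedding_ιX ν hkl).injective K) (m + 1 + 1)) :=
    isIso_localMap_of_isOpenEmbedding ℤ ℤ (c.isOpenEmbedding_ιX ν hkl) hK (m + 1 + 1)
  haveI iP : IsIso (relativeSingularHomology.map ℤ ℤ (c.ιP ν hkl)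
      (mapsTo_compl_image_of_injective (c.isOpenEmbedding_ιP ν hkl).injective K) (m + 1 + 1)) :=
    isIso_localMap_of_isOpenEmbedding ℤ ℤ (c.isOpenEmbedding_ιP ν hkl) hK (m + 1 + 1)
  set ξX := inv (relativeSingularHomology.map ℤ ℤ (c.ιX ν hkl)
      (mapsTo_compl_image_of_injective (c.isOpenEmbedding_ιX ν hkl).injective K) (m + 1 + 1))
    (singularHomology.toLocalOfSet ℤ ℤ _ (c.ιX ν hkl '' K) (m + 1 + 1) μ'.fundamentalClass) with hξX
  set ξP := inv (relativeSingularHomology.map ℤ ℤ (c.ιP ν hkl)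
      (mapsTo_compl_image_of_injective (c.isOpenEmbedding_ιP ν hkl).injective K) (m + 1 + 1))
    (singularHomology.toLocalOfSet ℤ ℤ _ (c.ιP ν hkl '' K) (m + 1 + 1) μ''.fundamentalClass)
    with hξP
  have hξX' : relativeSingularHomology.map ℤ ℤ (c.ιX ν hkl)
      (mapsTo_compl_image_of_injective (c.isOpenEmbedding_ιX ν hkl).injective K) (m + 1 + 1) ξX =
      singularHomology.toLocalOfSet ℤ ℤ _ (c.ιX ν hkl '' K) (m + 1 + 1) μ'.fundamentalClass := by
    rw [hξX, ← ModuleCat.comp_apply, IsIso.inv_hom_id, ModuleCat.id_apply]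
  have hξP' : relativeSingularHomology.map ℤ ℤ (c.ιP ν hkl)
      (mapsTo_compl_image_of_injective (c.isOpenEmbedding_ιP ν hkl).injective K) (m + 1 + 1) ξP =
      singularHomology.toLocalOfSet ℤ ℤ _ (c.ιP ν hkl '' K) (m + 1 + 1) μ''.fundamentalClass := by
    rw [hξP, ← ModuleCat.comp_apply, IsIso.inv_hom_id, ModuleCat.id_apply]
  -- the two pull-backs agree: same local images at every point of `K`
  have hξ : ξX = ξP := by
    refine localHomologyOfSet.eq_of_forall_restrictToPoint_eq_of_isCompact ℤ ℤ
      (X := ↥(c.commonPiece ν)) (Nat.le_add_left 1 (m + 1)) hK fun x hx => ?_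
    haveI := localHomology.isIso_map_of_isOpenEmbedding_of_eq ℤ ℤ (c.pieceIncl ν hkl)
      (c.isOpenEmbedding_pieceIncl ν hkl) x rfl (m + 1 + 1)
    apply injective_of_isIso (relativeSingularHomology.map ℤ ℤ (c.pieceIncl ν hkl)
      (LocalFamily.mapsTo_compl_pt (c.pieceIncl_injective ν hkl) x) (m + 1 + 1))
    exact (map_pieceIncl_restrictToPoint_eq_pieceClass_X (hkl := hkl) hμ' hx ξX hξX').trans
      (map_pieceIncl_restrictToPoint_eq_pieceClass_P hμ'' hloc hx ξP hξP').symm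
  -- push forward to `Z`
  have eX : singularHomology.toLocalOfSet ℤ ℤ _ (c.ιZ ν '' K) (m + 1 + 1)
      (singularHomology.map ℤ ℤ (c.collapseX ν hkl) (m + 1 + 1) μ'.fundamentalClass) =
      relativeSingularHomology.map ℤ ℤ (c.ιZ ν)
        (mapsTo_compl_image_of_injective (c.isOpenEmbedding_ιZ ν).injective K) (m + 1 + 1) ξX := by
    have nat := ConcreteCategory.congr_hom (relativeSingularHomology.ofAbsolute_comp_map
      (R := ℤ) (M := ℤ) (c.collapseX ν hkl) (c.mapsTo_collapseX ν hkl K) (m + 1 + 1)) μ'.fundamentalClass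
    rw [ModuleCat.comp_apply, ModuleCat.comp_apply] at nat
    change relativeSingularHomology.map ℤ ℤ (c.collapseX ν hkl) (c.mapsTo_collapseX ν hkl K) (m + 1 + 1)
      (singularHomology.toLocalOfSet ℤ ℤ _ (c.ιX ν hkl '' K) (m + 1 + 1) μ'.fundamentalClass) =
      singularHomology.toLocalOfSet ℤ ℤ _ (c.ιZ ν '' K) (m + 1 + 1)
        (singularHomology.map ℤ ℤ (c.collapseX ν hkl) (m + 1 + 1) μ'.fundamentalClass) at nat
    rw [← nat, ← hξX', ← ModuleCat.comp_apply, ← relativeSingularHomology.map_comp]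
    exact ConcreteCategory.congr_hom (relativeSingularHomology.map_congr_left ℤ ℤ
      (c.collapseX_comp_ιX ν hkl) _ _ (m + 1 + 1)) ξX
  have eP : singularHomology.toLocalOfSet ℤ ℤ _ (c.ιZ ν '' K) (m + 1 + 1)
      (singularHomology.map ℤ ℤ (c.collapseP ν hkl) (m + 1 + 1) μ''.fundamentalClass) =
      relativeSingularHomology.map ℤ ℤ (c.ιZ ν)
        (mapsTo_compl_image_of_injective (c.isOpenEmbedding_ιZ ν).injective K) (m + 1 + 1) ξP := by
    have nat := ConcreteCategory.congr_hom (relativeSingularHomology.ofAbsolute_comp_map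
      (R := ℤ) (M := ℤ) (c.collapseP ν hkl) (c.mapsTo_collapseP ν hkl K) (m + 1 + 1))
      μ''.fundamentalClass
    rw [ModuleCat.comp_apply, ModuleCat.comp_apply] at nat
    change relativeSingularHomology.map ℤ ℤ (c.collapseP ν hkl) (c.mapsTo_collapseP ν hkl K)
      (m + 1 + 1)
      (singularHomology.toLocalOfSet ℤ ℤ _ (c.ιP ν hkl '' K) (m + 1 + 1) μ''.fundamentalClass) =
      singularHomology.toLocalOfSet ℤ ℤ _ (c.ιZ ν '' K) (m + 1 + 1)
        (singularHomology.map ℤ ℤ (c.collapseP ν hkl) (m + 1 + 1) μ''.fundamentalClass) at nat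
    rw [← nat, ← hξP', ← ModuleCat.comp_apply, ← relativeSingularHomology.map_comp]
    exact ConcreteCategory.congr_hom (relativeSingularHomology.map_congr_left ℤ ℤ
      (c.collapseP_comp_ιP ν hkl) _ _ (m + 1 + 1)) ξP
  rw [eX, eP, hξ]

end FundamentalClassTransfer

/-! ### §5 The two collapses are isometric on classes supported away from `∞` -/

section Isometry

variable {c ν hkl}
variable {w : relativeSingularHomology ℤ ℤ c.W ((𝓡∂ (m + 1 + 1)).boundary c.W) (m + 1 + 1)}
  {w' : relativeSingularHomology ℤ ℤ (c.surgery ν hkl).W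
    ((𝓡∂ (m + 1 + 1)).boundary (c.surgery ν hkl).W) (m + 1 + 1)}
  {μ' : HomologicalOrientation ℤ (ClosedModel (m + 1) c.W) (m + 1 + 1)}
  {μ'' : HomologicalOrientation ℤ (ClosedModel (m + 1) (c.surgery ν hkl).W) (m + 1 + 1)}

/-- **The difference `π_* [Ŵ] - π'_* [χ̂]` comes from `Z ∖ K`** for every compact `K ⊆ U`
(exact sequence of the pair `(Z, Z ∖ K)`, Hatcher Thm. 2.16, and `toLocalOfSet_map_collapse_eq`).
[cite: HatcherAT2002, Thm. 2.16] -/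
theorem exists_map_subsetIncl_eq_sub
    (hμ' : μ'.fundamentalClass = c.closedModelClass ℤ ℤ (Nat.le_add_left 1 m) w)
    (hμ'' : μ''.fundamentalClass =
      (c.surgery ν hkl).closedModelClass ℤ ℤ (Nat.le_add_left 1 m) w')
    (hloc : ∀ (a : ↥ν.complement) (ha : (a : c.W) ∈ (𝓡∂ (m + 1 + 1)).interior c.W),
        relativeSingularHomology.toLocal ℤ ℤ ((𝓡∂ (m + 1 + 1)).boundary (c.surgery ν hkl).W)
            ⟨(c.surgeryPiece ν hkl).j a, (c.surgeryPiece ν hkl).j_mem_compl_boundary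
              (c.not_mem_boundary_of_mem_interior ha)⟩ (m + 1 + 1) w' =
          relativeSingularHomology.map ℤ ℤ (c.surgeryPiece ν hkl).j
            (LocalFamily.mapsTo_compl_pt (c.surgeryPiece ν hkl).j_injective a)
            (m + 1 + 1) ((c.surgeryPiece ν hkl).pieceClass w a))
    {K : Set ↥(c.commonPiece ν)} (hK : IsCompact K) :
    ∃ e : singularHomology ℤ ℤ ↥((c.ιZ ν '' K)ᶜ) (m + 1 + 1),
      singularHomology.map ℤ ℤ (subsetIncl ((c.ιZ ν '' K)ᶜ)) (m + 1 + 1) e =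
        singularHomology.map ℤ ℤ (c.collapseX ν hkl) (m + 1 + 1) μ'.fundamentalClass -
          singularHomology.map ℤ ℤ (c.collapseP ν hkl) (m + 1 + 1) μ''.fundamentalClass := by
  have hex := relativeSingularHomology.exact_map_ofAbsolute ℤ ℤ ((c.ιZ ν '' K)ᶜ) (m + 1 + 1)
  rw [ShortComplex.moduleCat_exact_iff] at hex
  refine hex _ ?_
  change singularHomology.toLocalOfSet ℤ ℤ _ (c.ιZ ν '' K) (m + 1 + 1) _ = 0
  rw [map_sub, sub_eq_zero]
  exact toLocalOfSet_map_collapse_eq hμ' hμ'' hloc hK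

/-- **The two collapses are isometric on classes supported in a compact part of `U`**
(Kervaire–Milnor 1963, §5–§7: the cup product pairings of `W` and `χ(W, φ)` agree off the
surgery): for `a ∈ Hᵖ(Z)` vanishing on `Z ∖ K` and any `b ∈ H^q(Z)`, `p + q = d`,
`⟨a ⌣ b, π_* [Ŵ]⟩ = ⟨a ⌣ b, π'_* [χ̂]⟩` — the difference is `⟨a ⌣ b, i_* e⟩ = ⟨i^*a ⌣ i^*b, e⟩ = 0`
(naturality of the Kronecker pairing and of `⌣`, Hatcher §3.1 p. 201 and Prop. 3.10).
[cite: KervaireMilnorAnnals1963, §5 and §7; HatcherAT2002, Prop. 3.10 and §3.1 p. 201] -/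
theorem kroneckerPairing_cupProduct_map_collapse_eq
    (hμ' : μ'.fundamentalClass = c.closedModelClass ℤ ℤ (Nat.le_add_left 1 m) w)
    (hμ'' : μ''.fundamentalClass =
      (c.surgery ν hkl).closedModelClass ℤ ℤ (Nat.le_add_left 1 m) w')
    (hloc : ∀ (a : ↥ν.complement) (ha : (a : c.W) ∈ (𝓡∂ (m + 1 + 1)).interior c.W),
        relativeSingularHomology.toLocal ℤ ℤ ((𝓡∂ (m + 1 + 1)).boundary (c.surgery ν hkl).W)
            ⟨(c.surgeryPiece ν hkl).j a, (c.surgeryPiece ν hkl).j_mem_compl_boundary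
              (c.not_mem_boundary_of_mem_interior ha)⟩ (m + 1 + 1) w' =
          relativeSingularHomology.map ℤ ℤ (c.surgeryPiece ν hkl).j
            (LocalFamily.mapsTo_compl_pt (c.surgeryPiece ν hkl).j_injective a)
            (m + 1 + 1) ((c.surgeryPiece ν hkl).pieceClass w a))
    {K : Set ↥(c.commonPiece ν)} (hK : IsCompact K) {p q : ℕ} (hpq : p + q = m + 1 + 1)
    (a : singularCohomology ℤ ℤ (c.collapseTarget ν) p)
    (b : singularCohomology ℤ ℤ (c.collapseTarget ν) q)
    (ha : singularCohomology.map ℤ ℤ (subsetIncl ((c.ιZ ν '' K)ᶜ)) p a = 0) :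
    kroneckerPairing ℤ ℤ (c.collapseTarget ν) (m + 1 + 1) (cupProduct hpq a b)
        (singularHomology.map ℤ ℤ (c.collapseX ν hkl) (m + 1 + 1) μ'.fundamentalClass) =
      kroneckerPairing ℤ ℤ (c.collapseTarget ν) (m + 1 + 1) (cupProduct hpq a b)
        (singularHomology.map ℤ ℤ (c.collapseP ν hkl) (m + 1 + 1) μ''.fundamentalClass) := by
  obtain ⟨e, he⟩ := exists_map_subsetIncl_eq_sub hμ' hμ'' hloc hK
  rw [← sub_eq_zero, ← map_sub, ← he, ← kroneckerPairing_map, cupProduct_map, ha, map_zero,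
    LinearMap.zero_apply, map_zero, LinearMap.zero_apply]

end Isometry

end NullCobordism

end Literature.Topology.FourManifolds
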